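import Summits.CriticalPhenomena.PercolationContinuityZ3.Theorems.PercNearOneGluingNoHeavyQuantSGCLightCellsBoth
import Summits.CriticalPhenomena.PercolationContinuityZ3.Theorems.PercNearOneGluingNoHeavyQuantFlowPieces
import Summits.CriticalPhenomena.PercolationContinuityZ3.Theorems.PercNearOneGluingNoHeavyQuantLawDecFlowsDecomposition
import HarnessLib

/-!
# QUANT lane R8, T-DEC, leg (III): the NO-LOW REGIME of the light cells PT / TT of `SingleGateConvClosed` (moment criterion for a gated
# product), and cell PT from CW on the regime "triple heavy-low-decomposable, `lo₁ + s₂` self-sufficient"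

builds on p205010 (kernel theorem, internal audit signed; external expert review pending)

Support file (`--supports stmt-CriticalPhenomena-4575`), QUANT lane, seat prim-quant-arm-3 (gen 121, typer g31's ask INBOX l.1170/l.1173),
rung R8 of `run/shared/lean/prim/quant/LADDER.md`.  Theorems only, standard axioms, no sorries, no definitions.  Companion of
`…QuantSGCLightPairPairHolds` (cell PP is a theorem by the same mechanism).

THE MECHANISM.  A gated product `P = gate_q(μ₁ ∗ μ₂)` of two probability laws (`μᵢ` on `{0..Mᵢ}`, mean `Tᵢ`) that is top-affordable in the
sum (`y·(M₁+M₂) ≤ t := q(T₁+T₂)`, the sum of the two factors' top-affordability hypotheses) and has NO NONZERO LOW ATOM at the layer `j′`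
(every charged `0 < k ≤ j′` has `t ≤ 2k`) is DEC(j′): lead g30's first-moment criterion in flow form `flowAtT_of_moment` (the zero ships
`P(k)(k−t)/t` to every `k > t`; Jensen) + `decAtT_of_flowAtT`.  Every charged atom of `μ₁ ∗ μ₂` is a sum of charged atoms
(`exists_of_lconv_pos`), so if the least atoms are `m₁`, `m₂` the product has no nonzero low at every layer `j′ < m₁ + m₂` and at every layer
whatsoever when `t ≤ 2(m₁ + m₂)`.
* `LawDec.exists_of_lconv_pos`, **`LawDec.gate_lconv_decAt_of_noLow`**, **`LawDec.gate_lconv_decAt_of_minAtoms`** — the mechanism.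
* **`LawDec.sgcLightPairTriple_decAt_of_le`** — cell PT's conclusion at every layer `j′` with `j′ < lo₁ + s₁ ∨ t ≤ 2(lo₁ + s₁)` (uses only
  the two top-affordability hypotheses; EXACT CENSUS arm-3 g121 `explore/pt_cover.py`: 184 378 of 193 138 PT layer instances, 95.5 %).
* **`LawDec.sgcLightTripleTriple_decAt_of_le`** — cell TT's conclusion at every layer `j′` with `j′ < s₁ + r₁ ∨ t ≤ 2(s₁ + r₁)`.
* **`LawDec.sgcLightPairTriple_decAt_of_windowMix_heavyLow`** — CW ⟹ PT's conclusion at layer `j′` when the triple is in the LOW case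
  `s₂ ≤ T₂`, its Lemma-P pair `{s₁, s₃; γ_A}` (`γ_A = (T₂−s₁)/(s₃−s₁)`) is HEAVY (`y(s₃−s₁) ≤ q(T₂−s₁)`), and `j′ < lo₁ + s₂ ∨ t ≤ 2(lo₁+s₂)`:
  `μ₂ = w_A·{s₁,s₃;γ_A} + w_B·{s₂,s₃;γ_B}` (typer g30's `triple_eq_twoPairs_low`), the piece `gate_q(μ₁ ∗ {s₁,s₃;γ_A})` is CW
  (arm-2 g35's `singleGateConvClosed_heavyMix_of_windowMix`, `μ₁` being an admissible first factor), the piece `gate_q(μ₁ ∗ {s₂,s₃;γ_B})`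
  has least atom `lo₁ + s₂` (no-low), and arm-2 g35's `decAtT_gate_lconv_of_pieces_right` reassembles (EXACT CENSUS: 8 076 of the 8 760
  PT layer instances WITH a nonzero low, 92 %).
* **`LawDec.sgcLightPairTriple_of_windowMix_of_residual`** — `WindowMixDEC →` (PT on the RESIDUAL sub-cell: a nonzero low `lo₁+s₁ ≤ j′`,
  `2(lo₁+s₁) < t`, and [`T₂ < s₂` ∨ `q(T₂−s₁) < y(s₃−s₁)` ∨ (`lo₁+s₂ ≤ j′` ∧ `2(lo₁+s₂) < t`)]) `→ SGCLightPairTriple`.  The residual is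
  684 / 193 138 layer instances of the census (case B 437, light `{s₁,s₃}` 196, low `lo₁+s₂` 51), all DEC (0 failures).
So in typer g30/g31's chain `singleGateConvClosed_of_bothLightCells : CW → PP → PT → TT → …` PP is gone (`sgcLightPairPair_holds`) and PT
shrinks to its residual given CW.  HONEST STATUS: PT (residual) / TT / L2 / L3 / CW / `SingleGateConvClosed` / `GateMove` / `TreeDEC` /
`FarTreeRow` remain OPEN; nothing here is a published result; RATE class log\* / honest sentence unchanged.

[this work]; moment criterion: prim-quant-lead g30; flow normal form: prim-quant-stmt g22; pieces hook / heavy mix: prim-quant-arm-2 g35;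
cells and triple bookkeeping: prim-quant-stmt g30/g31 (this lane).  The gluing rows served [cite: KozmaNitzan2024, Conjecture 3 (p. 15)];
product measure [cite: Grimmett1999, §1.3 p. 10].
-/

noncomputable section

namespace Summit.CriticalPhenomena.PercolationContinuityZ3.Theorems

namespace Quant

open Finset

/-- two-point law notation `TP[lo, hi, g, h] = g·[h = hi] + (1 − g)·[h = lo]` (as in the lane's other files). -/
local notation3 "TP[" lo ", " hi ", " g ", " h "]" =>
  (g : ℝ) * (if (h : ℕ) = (hi : ℕ) then (1 : ℝ) else 0) + (1 - (g : ℝ)) * (if (h : ℕ) = (lo : ℕ) then (1 : ℝ) else 0)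

/-- three-atom law notation `TR[s₁, s₂, s₃, p₁, p₂, p₃, h] = p₁·[h = s₁] + p₂·[h = s₂] + p₃·[h = s₃]`. -/
local notation3 "TR[" s₁ ", " s₂ ", " s₃ ", " p₁ ", " p₂ ", " p₃ ", " h "]" =>
  (p₁ : ℝ) * (if (h : ℕ) = (s₁ : ℕ) then (1 : ℝ) else 0) + (p₂ : ℝ) * (if (h : ℕ) = (s₂ : ℕ) then (1 : ℝ) else 0)
    + (p₃ : ℝ) * (if (h : ℕ) = (s₃ : ℕ) then (1 : ℝ) else 0)

namespace LawDec

/-! ### The mechanism: a top-affordable gated product without nonzero lows is DEC -/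

/-- a charged atom of the convolution of two nonnegative laws is a sum of two charged atoms. [folklore] -/
theorem exists_of_lconv_pos (M₁ M₂ : ℕ) (μ₁ μ₂ : ℕ → ℝ) (h1 : ∀ h, 0 ≤ μ₁ h) (h2 : ∀ h, 0 ≤ μ₂ h) (h : ℕ)
    (hpos : 0 < lconv M₁ M₂ μ₁ μ₂ h) : ∃ i k, i + k = h ∧ 0 < μ₁ i ∧ 0 < μ₂ k := by
  obtain ⟨i, -, hi⟩ := Finset.exists_ne_zero_of_sum_ne_zero hpos.ne'
  obtain ⟨k, -, hk⟩ := Finset.exists_ne_zero_of_sum_ne_zero hi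
  by_cases hik : i + k = h
  · rw [if_pos hik] at hk
    obtain ⟨ha, hb⟩ := mul_ne_zero_iff.1 hk
    exact ⟨i, k, hik, lt_of_le_of_ne (h1 i) (Ne.symm ha), lt_of_le_of_ne (h2 k) (Ne.symm hb)⟩
  · rw [if_neg hik] at hk
    exact absurd rfl hk

/-- **A TOP-AFFORDABLE GATED PRODUCT WITHOUT NONZERO LOWS IS DEC.**  `μ₁`, `μ₂` probability laws on `{0..M₁}`, `{0..M₂}` with means
`T₁`, `T₂`; gate `0 ≤ q ≤ 1`, floor `0 < y < 1`; `t := q(T₁ + T₂) > 0` (the mean of `P = gate_q(μ₁ ∗ μ₂)`), `y·(M₁ + M₂) ≤ t`; if every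
atom `1 ≤ k ≤ j′` with `2k < t` is uncharged in `μ₁ ∗ μ₂`, then `DECAt y j′ (M₁ + M₂) P` — `flowAtT_of_moment` + `decAtT_of_flowAtT`.
[this work] -/
theorem gate_lconv_decAt_of_noLow (y q T₁ T₂ : ℝ) (M₁ M₂ j' : ℕ) (μ₁ μ₂ : ℕ → ℝ)
    (hy0 : 0 < y) (hy1 : y < 1) (hq0 : 0 ≤ q) (hq1 : q ≤ 1)
    (h10 : ∀ h, 0 ≤ μ₁ h) (h11 : ∑ h ∈ Finset.range (M₁ + 1), μ₁ h = 1)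
    (hT₁ : ∑ h ∈ Finset.range (M₁ + 1), (h : ℝ) * μ₁ h = T₁)
    (h20 : ∀ h, 0 ≤ μ₂ h) (h21 : ∑ h ∈ Finset.range (M₂ + 1), μ₂ h = 1)
    (hT₂ : ∑ h ∈ Finset.range (M₂ + 1), (h : ℝ) * μ₂ h = T₂)
    (htpos : 0 < q * (T₁ + T₂)) (hta : y * ((M₁ : ℝ) + M₂) ≤ q * (T₁ + T₂))
    (hnolow : ∀ k, 1 ≤ k → k ≤ j' → 2 * (k : ℝ) < q * (T₁ + T₂) → lconv M₁ M₂ μ₁ μ₂ k = 0) :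
    DECAt y j' (M₁ + M₂) (gate (lconv M₁ M₂ μ₁ μ₂) q) := by
  obtain ⟨n0, nM, n1⟩ := gate_laws (M₁ + M₂) (lconv M₁ M₂ μ₁ μ₂) q hq0 hq1 (lconv_nonneg M₁ M₂ μ₁ μ₂ h10 h20)
    (fun k hk => lconv_eq_zero M₁ M₂ μ₁ μ₂ k hk) (sum_lconv M₁ M₂ μ₁ μ₂ h11 h21)
  have nmean : ∑ h ∈ Finset.range (M₁ + M₂ + 1), (h : ℝ) * gate (lconv M₁ M₂ μ₁ μ₂) q h = q * (T₁ + T₂) := by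
    rw [sum_mul_gate, sum_mul_lconv M₁ M₂ μ₁ μ₂ h11 h21, hT₁, hT₂]
  rw [decAt_iff_decAtT, nmean]
  refine decAtT_of_flowAtT y _ j' (M₁ + M₂) _ hy0 hy1 nM n1 ?_
  refine flowAtT_of_moment y _ j' (M₁ + M₂) _ hy0 hy1 htpos n0 ?_ ?_ ?_
  · intro l hl1 hlj hlow
    rw [gate_apply, hnolow l hl1 hlj hlow, if_neg (by omega)]; ring
  · push_cast; exact hta
  · rw [n1, nmean, mul_one]

/-- **THE SAME BY LEAST ATOMS.**  If every charged atom of `μ₁` is `≥ m₁` and every charged atom of `μ₂` is `≥ m₂`, the gated product is DEC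
at every layer `j′ < m₁ + m₂`, and at every layer when `t ≤ 2(m₁ + m₂)` (every charged atom of `μ₁ ∗ μ₂` is `≥ m₁ + m₂`,
`exists_of_lconv_pos`). [this work] -/
theorem gate_lconv_decAt_of_minAtoms (y q T₁ T₂ : ℝ) (M₁ M₂ m₁ m₂ j' : ℕ) (μ₁ μ₂ : ℕ → ℝ)
    (hy0 : 0 < y) (hy1 : y < 1) (hq0 : 0 ≤ q) (hq1 : q ≤ 1)
    (h10 : ∀ h, 0 ≤ μ₁ h) (h11 : ∑ h ∈ Finset.range (M₁ + 1), μ₁ h = 1)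
    (hT₁ : ∑ h ∈ Finset.range (M₁ + 1), (h : ℝ) * μ₁ h = T₁)
    (h20 : ∀ h, 0 ≤ μ₂ h) (h21 : ∑ h ∈ Finset.range (M₂ + 1), μ₂ h = 1)
    (hT₂ : ∑ h ∈ Finset.range (M₂ + 1), (h : ℝ) * μ₂ h = T₂)
    (htpos : 0 < q * (T₁ + T₂)) (hta : y * ((M₁ : ℝ) + M₂) ≤ q * (T₁ + T₂))
    (hm₁ : ∀ i, 0 < μ₁ i → m₁ ≤ i) (hm₂ : ∀ k, 0 < μ₂ k → m₂ ≤ k)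
    (hj : j' < m₁ + m₂ ∨ q * (T₁ + T₂) ≤ 2 * ((m₁ : ℝ) + m₂)) :
    DECAt y j' (M₁ + M₂) (gate (lconv M₁ M₂ μ₁ μ₂) q) := by
  refine gate_lconv_decAt_of_noLow y q T₁ T₂ M₁ M₂ j' μ₁ μ₂ hy0 hy1 hq0 hq1 h10 h11 hT₁ h20 h21 hT₂ htpos hta ?_
  intro k hk1 hkj hlow
  rcases (lconv_nonneg M₁ M₂ μ₁ μ₂ h10 h20 k).eq_or_lt with hz | hpos
  · exact hz.symm
  · exfalso
    obtain ⟨i, l, hil, hi, hl⟩ := exists_of_lconv_pos M₁ M₂ μ₁ μ₂ h10 h20 k hpos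
    have e1 := hm₁ i hi
    have e2 := hm₂ l hl
    have hge : m₁ + m₂ ≤ k := by omega
    have hge' : ((m₁ : ℝ) + m₂) ≤ k := by exact_mod_cast hge
    rcases hj with hj | hj
    · omega
    · linarith

/-! ### Cells PT and TT in the no-low regime -/

/-- charged atoms of a two-point law `{lo, hi; γ}` with `lo ≤ hi` are `≥ lo`. [folklore] -/
theorem tp_minAtom (lo hi : ℕ) (γ : ℝ) (hlohi : lo ≤ hi) (h : ℕ) (hpos : 0 < TP[lo, hi, γ, h]) : lo ≤ h := by
  by_contra hlt
  rw [if_neg (by omega), if_neg (by omega)] at hpos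
  simp at hpos

/-- charged atoms of a three-atom law with `s₁ < s₂ < s₃` are `≥ s₁`. [folklore] -/
theorem tr_minAtom (s₁ s₂ s₃ : ℕ) (p₁ p₂ p₃ : ℝ) (h12 : s₁ < s₂) (h23 : s₂ < s₃) (h : ℕ)
    (hpos : 0 < TR[s₁, s₂, s₃, p₁, p₂, p₃, h]) : s₁ ≤ h := by
  by_contra hlt
  rw [if_neg (by omega), if_neg (by omega), if_neg (by omega)] at hpos
  simp at hpos

/-- **CELL PT IN THE NO-LOW REGIME.**  For a pair `lo₁ < hi₁ ≤ M₁` (`0 ≤ γ₁ ≤ 1`, `y·M₁ ≤ q·T₁`) and a triple `s₁ < s₂ < s₃ ≤ M₂`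
(`pᵢ ≥ 0`, `Σ pᵢ = 1`, mean `T₂`, `y·M₂ ≤ q·T₂`), gate `0 < q ≤ 1`, floor `0 < y < 1`: `gate_q(μ₁ ∗ μ₂)` is DEC at every layer `j′`
with `j′ < lo₁ + s₁` or `t = q(T₁ + T₂) ≤ 2(lo₁ + s₁)`.  (None of lightness, non-HD or the factors' DEC data is needed here.) [this work] -/
theorem sgcLightPairTriple_decAt_of_le (y q γ₁ p₁ p₂ p₃ T₂ : ℝ) (M₁ M₂ lo₁ hi₁ s₁ s₂ s₃ j' : ℕ)
    (hy0 : 0 < y) (hy1 : y < 1) (hq0 : 0 < q) (hq1 : q ≤ 1)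
    (hlohi₁ : lo₁ < hi₁) (hhi₁ : hi₁ ≤ M₁) (hγ₁0 : 0 ≤ γ₁) (hγ₁1 : γ₁ ≤ 1)
    (hta₁ : y * (M₁ : ℝ) ≤ q * ((lo₁ : ℝ) + ((hi₁ : ℝ) - lo₁) * γ₁))
    (h12 : s₁ < s₂) (h23 : s₂ < s₃) (h3 : s₃ ≤ M₂) (hp₁ : 0 ≤ p₁) (hp₂ : 0 ≤ p₂) (hp₃ : 0 ≤ p₃) (hp : p₁ + p₂ + p₃ = 1)
    (hT : p₁ * (s₁ : ℝ) + p₂ * (s₂ : ℝ) + p₃ * (s₃ : ℝ) = T₂) (hta₂ : y * (M₂ : ℝ) ≤ q * T₂)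
    (hle : j' < lo₁ + s₁ ∨ q * (((lo₁ : ℝ) + ((hi₁ : ℝ) - lo₁) * γ₁) + T₂) ≤ 2 * ((lo₁ : ℝ) + s₁)) :
    DECAt y j' (M₁ + M₂) (gate (lconv M₁ M₂ (fun h => TP[lo₁, hi₁, γ₁, h]) (fun h => TR[s₁, s₂, s₃, p₁, p₂, p₃, h])) q) := by
  obtain ⟨a0, -, a1, amean⟩ := tp_laws M₁ lo₁ hi₁ γ₁ hγ₁0 hγ₁1 hlohi₁.le hhi₁
  obtain ⟨b0, -, b1, bmean⟩ := triple_laws' p₁ p₂ p₃ T₂ M₂ s₁ s₂ s₃ (by omega) (by omega) h3 hp₁ hp₂ hp₃ hp hT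
  have hM₁ : (1 : ℝ) ≤ M₁ := by
    exact_mod_cast (Nat.succ_le_of_lt (Nat.lt_of_le_of_lt (Nat.zero_le lo₁) (Nat.lt_of_lt_of_le hlohi₁ hhi₁)))
  have hT₂0 : 0 ≤ T₂ := by
    rw [← hT]
    exact add_nonneg (add_nonneg (mul_nonneg hp₁ (Nat.cast_nonneg _)) (mul_nonneg hp₂ (Nat.cast_nonneg _)))
      (mul_nonneg hp₃ (Nat.cast_nonneg _))
  have htpos : 0 < q * (((lo₁ : ℝ) + ((hi₁ : ℝ) - lo₁) * γ₁) + T₂) := by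
    have h1 : 0 < y * (M₁ : ℝ) := mul_pos hy0 (by linarith)
    rw [mul_add]; exact add_pos_of_pos_of_nonneg (lt_of_lt_of_le h1 hta₁) (mul_nonneg hq0.le hT₂0)
  have hta : y * ((M₁ : ℝ) + M₂) ≤ q * (((lo₁ : ℝ) + ((hi₁ : ℝ) - lo₁) * γ₁) + T₂) := by
    rw [mul_add, mul_add]; exact add_le_add hta₁ hta₂
  exact gate_lconv_decAt_of_minAtoms y q _ T₂ M₁ M₂ lo₁ s₁ j' _ _ hy0 hy1 hq0.le hq1 a0 a1 amean b0 b1 bmean htpos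
    hta (fun i hi => tp_minAtom lo₁ hi₁ γ₁ hlohi₁.le i hi) (fun k hk => tr_minAtom s₁ s₂ s₃ p₁ p₂ p₃ h12 h23 k hk) hle

/-- **CELL TT IN THE NO-LOW REGIME.**  For triples `s₁ < s₂ < s₃ ≤ M₁` (masses `pᵢ ≥ 0`, mean `T₁`, `y·M₁ ≤ q·T₁`) and
`r₁ < r₂ < r₃ ≤ M₂` (masses `wᵢ ≥ 0`, mean `T₂`, `y·M₂ ≤ q·T₂`): `gate_q(μ₁ ∗ μ₂)` is DEC at every layer `j′` with `j′ < s₁ + r₁` or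
`q(T₁ + T₂) ≤ 2(s₁ + r₁)`. [this work] -/
theorem sgcLightTripleTriple_decAt_of_le (y q p₁ p₂ p₃ T₁ w₁ w₂ w₃ T₂ : ℝ) (M₁ M₂ s₁ s₂ s₃ r₁ r₂ r₃ j' : ℕ)
    (hy0 : 0 < y) (hy1 : y < 1) (hq0 : 0 < q) (hq1 : q ≤ 1)
    (h12 : s₁ < s₂) (h23 : s₂ < s₃) (h3 : s₃ ≤ M₁) (hp₁ : 0 ≤ p₁) (hp₂ : 0 ≤ p₂) (hp₃ : 0 ≤ p₃) (hp : p₁ + p₂ + p₃ = 1)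
    (hT₁ : p₁ * (s₁ : ℝ) + p₂ * (s₂ : ℝ) + p₃ * (s₃ : ℝ) = T₁) (hta₁ : y * (M₁ : ℝ) ≤ q * T₁)
    (g12 : r₁ < r₂) (g23 : r₂ < r₃) (g3 : r₃ ≤ M₂) (hw₁ : 0 ≤ w₁) (hw₂ : 0 ≤ w₂) (hw₃ : 0 ≤ w₃) (hw : w₁ + w₂ + w₃ = 1)
    (hT₂ : w₁ * (r₁ : ℝ) + w₂ * (r₂ : ℝ) + w₃ * (r₃ : ℝ) = T₂) (hta₂ : y * (M₂ : ℝ) ≤ q * T₂)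
    (hle : j' < s₁ + r₁ ∨ q * (T₁ + T₂) ≤ 2 * ((s₁ : ℝ) + r₁)) :
    DECAt y j' (M₁ + M₂)
      (gate (lconv M₁ M₂ (fun h => TR[s₁, s₂, s₃, p₁, p₂, p₃, h]) (fun h => TR[r₁, r₂, r₃, w₁, w₂, w₃, h])) q) := by
  obtain ⟨a0, -, a1, amean⟩ := triple_laws' p₁ p₂ p₃ T₁ M₁ s₁ s₂ s₃ (by omega) (by omega) h3 hp₁ hp₂ hp₃ hp hT₁
  obtain ⟨b0, -, b1, bmean⟩ := triple_laws' w₁ w₂ w₃ T₂ M₂ r₁ r₂ r₃ (by omega) (by omega) g3 hw₁ hw₂ hw₃ hw hT₂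
  have hM₁ : (1 : ℝ) ≤ M₁ := by
    exact_mod_cast (Nat.succ_le_of_lt (Nat.lt_of_le_of_lt (Nat.zero_le s₂) (Nat.lt_of_lt_of_le h23 h3)))
  have hT₂0 : 0 ≤ T₂ := by
    rw [← hT₂]
    exact add_nonneg (add_nonneg (mul_nonneg hw₁ (Nat.cast_nonneg _)) (mul_nonneg hw₂ (Nat.cast_nonneg _)))
      (mul_nonneg hw₃ (Nat.cast_nonneg _))
  have htpos : 0 < q * (T₁ + T₂) := by
    have h1 : 0 < y * (M₁ : ℝ) := mul_pos hy0 (by linarith)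
    rw [mul_add]; exact add_pos_of_pos_of_nonneg (lt_of_lt_of_le h1 hta₁) (mul_nonneg hq0.le hT₂0)
  have hta : y * ((M₁ : ℝ) + M₂) ≤ q * (T₁ + T₂) := by rw [mul_add, mul_add]; exact add_le_add hta₁ hta₂
  exact gate_lconv_decAt_of_minAtoms y q T₁ T₂ M₁ M₂ s₁ r₁ j' _ _ hy0 hy1 hq0.le hq1 a0 a1 amean b0 b1 bmean htpos
    hta (fun i hi => tr_minAtom s₁ s₂ s₃ p₁ p₂ p₃ h12 h23 i hi) (fun k hk => tr_minAtom r₁ r₂ r₃ w₁ w₂ w₃ g12 g23 k hk)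
    hle

/-! ### Cell PT from CW when the triple's low Lemma-P pair is heavy -/

/-- **CW ⟹ PT WHEN `s₂ ≤ T₂`, `{s₁, s₃; γ_A}` IS HEAVY AND `lo₁ + s₂` IS NOT A LOW.**  In PT's binder (the light pair `μ₁ = {lo₁, hi₁; γ₁}`
admissible: top-affordable with `gate_q μ₁` DEC at every layer `j′ < M₁`; the triple with positive masses, mean `T₂`, `y·M₂ ≤ q·T₂`),
suppose `s₂ ≤ T₂`, `y·(s₃ − s₁) ≤ q·(T₂ − s₁)` and `j′ < lo₁ + s₂ ∨ t ≤ 2(lo₁ + s₂)`.  Then `gate_q(μ₁ ∗ μ₂)` is DEC at `j′ < M₁ + M₂`: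
write `μ₂ = w_A·{s₁, s₃; γ_A} + w_B·{s₂, s₃; γ_B}` (`triple_eq_twoPairs_low`); the first piece is CW (`singleGateConvClosed_heavyMix_of_windowMix`,
`μ₁` the admissible first factor, the heavy pair the component), the second has least atoms `lo₁`, `s₂` (`gate_lconv_decAt_of_minAtoms`);
`decAtT_gate_lconv_of_pieces_right` at the common target `q(T₁ + T₂)`. [this work] -/
theorem sgcLightPairTriple_decAt_of_windowMix_heavyLow (hCW : WindowMixDEC) (y q γ₁ p₁ p₂ p₃ T₂ : ℝ)
    (M₁ M₂ lo₁ hi₁ s₁ s₂ s₃ j' : ℕ)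
    (hy0 : 0 < y) (hy1 : y < 1) (hq0 : 0 < q) (hq1 : q ≤ 1)
    (hlohi₁ : lo₁ < hi₁) (hhi₁ : hi₁ ≤ M₁) (hγ₁0 : 0 ≤ γ₁) (hγ₁1 : γ₁ ≤ 1)
    (hta₁ : y * (M₁ : ℝ) ≤ q * ((lo₁ : ℝ) + ((hi₁ : ℝ) - lo₁) * γ₁))
    (hD₁ : ∀ j', j' < M₁ → DECAt y j' M₁ (gate (fun h => TP[lo₁, hi₁, γ₁, h]) q))
    (h12 : s₁ < s₂) (h23 : s₂ < s₃) (h3 : s₃ ≤ M₂) (hp₁ : 0 < p₁) (hp₂ : 0 < p₂) (hp₃ : 0 < p₃) (hp : p₁ + p₂ + p₃ = 1)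
    (hT : p₁ * (s₁ : ℝ) + p₂ * (s₂ : ℝ) + p₃ * (s₃ : ℝ) = T₂) (hta₂ : y * (M₂ : ℝ) ≤ q * T₂)
    (hA : (s₂ : ℝ) ≤ T₂) (hheavy : y * ((s₃ : ℝ) - s₁) ≤ q * (T₂ - s₁))
    (hle : j' < lo₁ + s₂ ∨ q * (((lo₁ : ℝ) + ((hi₁ : ℝ) - lo₁) * γ₁) + T₂) ≤ 2 * ((lo₁ : ℝ) + s₂))
    (hj : j' < M₁ + M₂) :
    DECAt y j' (M₁ + M₂) (gate (lconv M₁ M₂ (fun h => TP[lo₁, hi₁, γ₁, h]) (fun h => TR[s₁, s₂, s₃, p₁, p₂, p₃, h])) q) := by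
  -- names for the mean of the pair and the data of the two Lemma-P pairs of the triple
  obtain ⟨T₁, hT₁⟩ : ∃ T : ℝ, T = (lo₁ : ℝ) + ((hi₁ : ℝ) - lo₁) * γ₁ := ⟨_, rfl⟩
  rw [← hT₁] at hta₁ hle
  obtain ⟨a0, aM, a1, amean⟩ := tp_laws M₁ lo₁ hi₁ γ₁ hγ₁0 hγ₁1 hlohi₁.le hhi₁
  rw [← hT₁] at amean
  have hta₁' : y * (M₁ : ℝ) ≤ q * ∑ h ∈ Finset.range (M₁ + 1), (h : ℝ) * TP[lo₁, hi₁, γ₁, h] := by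
    rw [amean]; exact hta₁
  have hs13 : (s₁ : ℝ) < s₃ := by exact_mod_cast h12.trans h23
  have hs23 : (s₂ : ℝ) < s₃ := by exact_mod_cast h23
  have hs12 : (s₁ : ℝ) < s₂ := by exact_mod_cast h12
  have hT3 : T₂ < (s₃ : ℝ) := by
    nlinarith [mul_pos hp₁ (sub_pos.2 hs13), mul_pos hp₂ (sub_pos.2 hs23)]
  have hT1 : (s₁ : ℝ) < T₂ := lt_of_lt_of_le hs12 hA
  have hd₁ : (0 : ℝ) < (s₃ : ℝ) - s₁ := by linarith
  have hd₂ : (0 : ℝ) < (s₃ : ℝ) - s₂ := by linarith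
  have hd₃ : (0 : ℝ) < (s₃ : ℝ) - T₂ := by linarith
  have hd₁' : (s₃ : ℝ) - s₁ ≠ 0 := hd₁.ne'
  have hd₂' : (s₃ : ℝ) - s₂ ≠ 0 := hd₂.ne'
  have hd₃' : (s₃ : ℝ) - T₂ ≠ 0 := hd₃.ne'
  obtain ⟨γA, hγA⟩ : ∃ g : ℝ, g = (T₂ - s₁) / ((s₃ : ℝ) - s₁) := ⟨_, rfl⟩
  obtain ⟨γB, hγB⟩ : ∃ g : ℝ, g = (T₂ - s₂) / ((s₃ : ℝ) - s₂) := ⟨_, rfl⟩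
  obtain ⟨wA, hwA⟩ : ∃ w : ℝ, w = p₁ * ((s₃ : ℝ) - s₁) / ((s₃ : ℝ) - T₂) := ⟨_, rfl⟩
  obtain ⟨wB, hwB⟩ : ∃ w : ℝ, w = p₂ * ((s₃ : ℝ) - s₂) / ((s₃ : ℝ) - T₂) := ⟨_, rfl⟩
  have hγA0 : 0 ≤ γA := by rw [hγA]; exact div_nonneg (by linarith) hd₁.le
  have hγA1 : γA ≤ 1 := by rw [hγA, div_le_one hd₁]; linarith
  have hγB0 : 0 ≤ γB := by rw [hγB]; exact div_nonneg (by linarith) hd₂.le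
  have hγB1 : γB ≤ 1 := by rw [hγB, div_le_one hd₂]; linarith
  have hmeanA : (s₁ : ℝ) + ((s₃ : ℝ) - s₁) * γA = T₂ := by rw [hγA]; field_simp; ring
  have hmeanB : (s₂ : ℝ) + ((s₃ : ℝ) - s₂) * γB = T₂ := by rw [hγB]; field_simp; ring
  have hwA0 : 0 ≤ wA := by rw [hwA]; exact div_nonneg (mul_nonneg hp₁.le hd₁.le) hd₃.le
  have hwB0 : 0 ≤ wB := by rw [hwB]; exact div_nonneg (mul_nonneg hp₂.le hd₂.le) hd₃.le
  have hw1 : wA + wB = 1 := by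
    have hnum : p₁ * ((s₃ : ℝ) - s₁) + p₂ * ((s₃ : ℝ) - s₂) = (s₃ : ℝ) - T₂ := by
      linear_combination (s₃ : ℝ) * hp - hT
    rw [hwA, hwB, ← add_div, hnum, div_self hd₃']
  have hheavyA : y ≤ q * γA := by
    rw [hγA, mul_div_assoc', le_div_iff₀ hd₁]; linarith
  -- the decomposition of the triple over `Bool` (true ↦ the heavy pair A, false ↦ the pair B)
  have hv0 : ∀ b : Bool, 0 ≤ cond b wA wB := fun b => by cases b; exacts [hwB0, hwA0]
  have hv1 : ∑ b : Bool, cond b wA wB = 1 := by rw [Fintype.sum_bool]; exact hw1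
  have hμ₂ : ∀ h, TR[s₁, s₂, s₃, p₁, p₂, p₃, h] =
      ∑ b : Bool, cond b wA wB * cond b (TP[s₁, s₃, γA, h]) (TP[s₂, s₃, γB, h]) := by
    intro h
    rw [Fintype.sum_bool]
    show _ = wA * TP[s₁, s₃, γA, h] + wB * TP[s₂, s₃, γB, h]
    rw [hwA, hwB, hγA, hγB]
    exact triple_eq_twoPairs_low p₁ p₂ p₃ T₂ s₁ s₂ s₃ h12 h23 hp hT hT3 h
  -- the common target `q (T₁ + T₂)` is the mean of the product
  obtain ⟨-, -, b1, bmean⟩ := triple_laws' p₁ p₂ p₃ T₂ M₂ s₁ s₂ s₃ (by omega) (by omega) h3 hp₁.le hp₂.le hp₃.le hp hT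
  have hmeanP : ∑ h ∈ Finset.range (M₁ + M₂ + 1),
      (h : ℝ) * gate (lconv M₁ M₂ (fun h => TP[lo₁, hi₁, γ₁, h]) (fun h => TR[s₁, s₂, s₃, p₁, p₂, p₃, h])) q h
        = q * (T₁ + T₂) := by
    rw [sum_mul_gate, sum_mul_lconv M₁ M₂ _ _ a1 b1, amean, bmean]
  rw [decAt_iff_decAtT, hmeanP]
  refine decAtT_gate_lconv_of_pieces_right y (q * (T₁ + T₂)) q j' (M₁ + M₂) M₁ M₂ _ _ (fun b => cond b wA wB)
    (fun b h => cond b (TP[s₁, s₃, γA, h]) (TP[s₂, s₃, γB, h])) hv0 hv1 hμ₂ fun b _ => ?_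
  cases b with
  | true =>
    -- the heavy piece: CW
    show DECAtT y (q * (T₁ + T₂)) j' (M₁ + M₂)
      (gate (lconv M₁ M₂ (fun h => TP[lo₁, hi₁, γ₁, h]) (fun h => TP[s₁, s₃, γA, h])) q)
    have h := singleGateConvClosed_heavyMix_of_windowMix hCW y q T₂ M₁ M₂ (fun h => TP[lo₁, hi₁, γ₁, h]) (ι := Unit)
      (fun _ => (1 : ℝ)) (fun _ => γA) (fun _ => s₁) (fun _ => s₃) hy0 hy1 hq0 hq1 a0 aM a1 hta₁' hD₁
      (fun _ => zero_le_one) (by simp) (fun _ => hγA1) (fun _ => hheavyA) (fun _ => (h12.trans h23).le) (fun _ => h3)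
      (fun _ => hmeanA) j' hj
    have e : (fun h => ∑ _i : Unit, (1 : ℝ) * TP[s₁, s₃, γA, h]) = fun h => TP[s₁, s₃, γA, h] := by
      funext h; simp only [Finset.univ_unique, Finset.sum_singleton, one_mul]
    rw [e, decAt_iff_decAtT] at h
    obtain ⟨-, -, c1, cmean⟩ := tp_laws M₂ s₁ s₃ γA hγA0 hγA1 (h12.trans h23).le h3
    rw [sum_mul_gate, sum_mul_lconv M₁ M₂ _ _ a1 c1, amean, cmean, hmeanA] at h
    exact h
  | false =>
    -- the light piece has least atoms `lo₁`, `s₂`: no-low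
    show DECAtT y (q * (T₁ + T₂)) j' (M₁ + M₂)
      (gate (lconv M₁ M₂ (fun h => TP[lo₁, hi₁, γ₁, h]) (fun h => TP[s₂, s₃, γB, h])) q)
    obtain ⟨c0, -, c1, cmean⟩ := tp_laws M₂ s₂ s₃ γB hγB0 hγB1 h23.le h3
    rw [hmeanB] at cmean
    have hM₁ : (1 : ℝ) ≤ M₁ := by
      exact_mod_cast (Nat.succ_le_of_lt (Nat.lt_of_le_of_lt (Nat.zero_le lo₁) (Nat.lt_of_lt_of_le hlohi₁ hhi₁)))
    have hT₂0 : 0 ≤ T₂ := le_of_lt (lt_of_le_of_lt (Nat.cast_nonneg s₁) hT1)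
    have htpos : 0 < q * (T₁ + T₂) := by
      have h1 : 0 < y * (M₁ : ℝ) := mul_pos hy0 (by linarith)
      rw [mul_add]; exact add_pos_of_pos_of_nonneg (lt_of_lt_of_le h1 hta₁) (mul_nonneg hq0.le hT₂0)
    have hta : y * ((M₁ : ℝ) + M₂) ≤ q * (T₁ + T₂) := by rw [mul_add, mul_add]; exact add_le_add hta₁ hta₂
    have h := gate_lconv_decAt_of_minAtoms y q T₁ T₂ M₁ M₂ lo₁ s₂ j' (fun h => TP[lo₁, hi₁, γ₁, h])
      (fun h => TP[s₂, s₃, γB, h]) hy0 hy1 hq0.le hq1 a0 a1 amean c0 c1 cmean htpos hta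
      (fun i hi => tp_minAtom lo₁ hi₁ γ₁ hlohi₁.le i hi) (fun k hk => tp_minAtom s₂ s₃ γB h23.le k hk) hle
    rw [decAt_iff_decAtT, sum_mul_gate, sum_mul_lconv M₁ M₂ _ _ a1 c1, amean, cmean] at h
    exact h

/-! ### Assembly: PT from CW and its residual sub-cell -/

/-- **CELL PT ⟸ CW + ITS RESIDUAL SUB-CELL.**  The residual hypothesis is PT's own binder restricted to the layers / parameters NOT covered
by `sgcLightPairTriple_decAt_of_le` (a nonzero low is present: `lo₁ + s₁ ≤ j′`, `2(lo₁ + s₁) < t`) nor by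
`sgcLightPairTriple_decAt_of_windowMix_heavyLow` (`T₂ < s₂`, or `{s₁, s₃}` light: `q(T₂ − s₁) < y(s₃ − s₁)`, or `lo₁ + s₂` a low:
`lo₁ + s₂ ≤ j′ ∧ 2(lo₁ + s₂) < t`).  EXACT CENSUS (arm-3 g121): the residual is 684 of 193 138 PT layer instances, 0 DEC failures. [this work] -/
theorem sgcLightPairTriple_of_windowMix_of_residual (hCW : WindowMixDEC)
    (hR : ∀ (y q γ₁ p₁ p₂ p₃ T₂ : ℝ) (M₁ M₂ lo₁ hi₁ s₁ s₂ s₃ : ℕ),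
      0 < y → y < 1 → 0 < q → q ≤ 1 →
      lo₁ < hi₁ → hi₁ ≤ M₁ → 0 ≤ γ₁ → γ₁ ≤ 1 → q * γ₁ < y →
      y * (M₁ : ℝ) ≤ q * ((lo₁ : ℝ) + ((hi₁ : ℝ) - lo₁) * γ₁) →
      (∀ j', j' < M₁ → DECAt y j' M₁ (gate (fun h => TP[lo₁, hi₁, γ₁, h]) q)) →
      s₁ < s₂ → s₂ < s₃ → s₃ ≤ M₂ → 0 < p₁ → 0 < p₂ → 0 < p₃ → p₁ + p₂ + p₃ = 1 →
      p₁ * (s₁ : ℝ) + p₂ * (s₂ : ℝ) + p₃ * (s₃ : ℝ) = T₂ →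
      y * (M₂ : ℝ) ≤ q * T₂ →
      ((s₂ : ℝ) ≤ T₂ ∧ q * (T₂ - s₂) < y * ((s₃ : ℝ) - s₂) ∨ T₂ < (s₂ : ℝ) ∧ q * (T₂ - s₁) < y * ((s₃ : ℝ) - s₁)) →
      (∀ j', j' < M₂ → DECAt y j' M₂ (gate (fun h => TR[s₁, s₂, s₃, p₁, p₂, p₃, h]) q)) →
      ∀ j', j' < M₁ + M₂ → lo₁ + s₁ ≤ j' →
        2 * ((lo₁ : ℝ) + s₁) < q * (((lo₁ : ℝ) + ((hi₁ : ℝ) - lo₁) * γ₁) + T₂) →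
        (T₂ < (s₂ : ℝ) ∨ q * (T₂ - s₁) < y * ((s₃ : ℝ) - s₁) ∨
          (lo₁ + s₂ ≤ j' ∧ 2 * ((lo₁ : ℝ) + s₂) < q * (((lo₁ : ℝ) + ((hi₁ : ℝ) - lo₁) * γ₁) + T₂))) →
        DECAt y j' (M₁ + M₂)
          (gate (lconv M₁ M₂ (fun h => TP[lo₁, hi₁, γ₁, h]) (fun h => TR[s₁, s₂, s₃, p₁, p₂, p₃, h])) q)) :
    SGCLightPairTriple := by
  intro y q γ₁ p₁ p₂ p₃ T₂ M₁ M₂ lo₁ hi₁ s₁ s₂ s₃ hy0 hy1 hq0 hq1 hlohi₁ hhi₁ hγ₁0 hγ₁1 hlight₁ hta₁ hD₁ h12 h23 h3 hp₁ hp₂ hp₃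
    hp hT hta₂ hnotHD hD₂ j' hj'
  by_cases h1 : j' < lo₁ + s₁ ∨ q * (((lo₁ : ℝ) + ((hi₁ : ℝ) - lo₁) * γ₁) + T₂) ≤ 2 * ((lo₁ : ℝ) + s₁)
  · exact sgcLightPairTriple_decAt_of_le y q γ₁ p₁ p₂ p₃ T₂ M₁ M₂ lo₁ hi₁ s₁ s₂ s₃ j' hy0 hy1 hq0 hq1 hlohi₁ hhi₁ hγ₁0 hγ₁1
      hta₁ h12 h23 h3 hp₁.le hp₂.le hp₃.le hp hT hta₂ h1
  have hj1 : lo₁ + s₁ ≤ j' := by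
    by_contra hc
    exact h1 (Or.inl (by omega))
  have ht1 : 2 * ((lo₁ : ℝ) + s₁) < q * (((lo₁ : ℝ) + ((hi₁ : ℝ) - lo₁) * γ₁) + T₂) := by
    by_contra hc
    exact h1 (Or.inr (not_lt.1 hc))
  have hR' := hR y q γ₁ p₁ p₂ p₃ T₂ M₁ M₂ lo₁ hi₁ s₁ s₂ s₃ hy0 hy1 hq0 hq1 hlohi₁ hhi₁ hγ₁0 hγ₁1 hlight₁ hta₁ hD₁ h12 h23 h3
    hp₁ hp₂ hp₃ hp hT hta₂ hnotHD hD₂ j' hj' hj1 ht1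
  by_cases hA : (s₂ : ℝ) ≤ T₂
  · by_cases hH : y * ((s₃ : ℝ) - s₁) ≤ q * (T₂ - s₁)
    · by_cases h2 : j' < lo₁ + s₂ ∨ q * (((lo₁ : ℝ) + ((hi₁ : ℝ) - lo₁) * γ₁) + T₂) ≤ 2 * ((lo₁ : ℝ) + s₂)
      · exact sgcLightPairTriple_decAt_of_windowMix_heavyLow hCW y q γ₁ p₁ p₂ p₃ T₂ M₁ M₂ lo₁ hi₁ s₁ s₂ s₃ j' hy0 hy1 hq0 hq1
          hlohi₁ hhi₁ hγ₁0 hγ₁1 hta₁ hD₁ h12 h23 h3 hp₁ hp₂ hp₃ hp hT hta₂ hA hH h2 hj'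
      · have hj2 : lo₁ + s₂ ≤ j' := by
          by_contra hc
          exact h2 (Or.inl (by omega))
        have ht2 : 2 * ((lo₁ : ℝ) + s₂) < q * (((lo₁ : ℝ) + ((hi₁ : ℝ) - lo₁) * γ₁) + T₂) := by
          by_contra hc
          exact h2 (Or.inr (not_lt.1 hc))
        exact hR' (Or.inr (Or.inr ⟨hj2, ht2⟩))
    · exact hR' (Or.inr (Or.inl (not_le.1 hH)))
  · exact hR' (Or.inl (not_le.1 hA))

end LawDec

end Quant

end Summit.CriticalPhenomena.PercolationContinuityZ3.Theorems
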